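import Summits.BirchSwinnertonDyer.BirchSwinnertonDyer.Theses.ErratumRoadFive
import Summits.BirchSwinnertonDyer.BirchSwinnertonDyer.Theorems.ErratumRoadFiveErratumThm23SelfDualIrrKOfTwoVarCoreDivPin

/-!
# v1‡ MINTED (= turnkey v2♭‡ of bsd-stepL-imc-p1 g34 with the result type retyped to the minted twin crux decl; TURNKEY, NOT KEYED — W-79:
# the pen keys; planner RULING 107, 2026-08-29T07:17:40Z, ask (T1)) of the birth skeleton `Cruxes/ErratumThm23SigmaLeSelfDualIrrK/Lines/erratum_chain.lean`
# for the RE-KEYED deciding crux `ErratumRoadFive.ErratumThm23SigmaLeSelfDualIrrK := F4♯‡`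
# (`Castella2018.erratumThm23_charIdeal_sigma_le_of_isTorsion_selfDual_irrK_OPEN`, p675866; RULING 86 (c) ∕ 107 RAMFREE re-key) —
# g31's v1‡ (3a241c8d5c8e7c57) with its ONE stub WEAKENED (the unit cofactor of the pin was IDLE, imc-p1 g34 K7) and `_of` concluding the ROUTE DECL

This is `HOME/imc-p1/g31/erratum_chain_irrK-v1-proposed.lean` (v1‡) with EXACTLY two edits: (1) the ONE stub is S1♭‡
`stub_FW21_twoVarSigmaLeDivPinned_selfDual_irrK` := S1‡ with the pin clause `∃ u : (𝓞_ℂp⟦T_a⟧)ˣ, constantCoeff Q₂ = ↑u * Q` replaced by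
`∃ c : 𝓞_ℂp⟦T_a⟧, constantCoeff Q₂ = c * Q` (the BDP frame `Q` DIVIDES `Q₂(T_c = 0)`; cofactor NOT asked to be a unit), every other character
identical (print-faithful (i) irr_K ∕ (iii) ∃ `q ∥ M` non-split, as in v1‡); (2) `_of` is the tree theorem
`Theorems.ErratumThm23TwoVariable.ErratumChainSelfDualIrrKDivPin.erratumThm23SigmaLeSelfDualIrrK_OPEN_of_twoVarCoreDivPinIrrK_of_thm326`
(imc-p1 g34, file `Theorems/ErratumRoadFiveErratumThm23SelfDualIrrKOfTwoVarCoreDivPin.lean` = p690124's body with `⟨u, hu⟩ ↦ ⟨c, hc⟩`).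
WHY: see `Lines/erratum_chain.lean` v4♭ ∕ memo `HOME/imc-p1/g34/K7-DIVPIN-imc-p1-g34.md` — the unit is consumed only by `Ideal.mul_mem_left`
in every landed composition; S1‡ ⟹ S1♭‡ binder for binder (`DivPin.exists_divPin_of_exists_unitPin`); S1♭‡ drops the «up to a p-adic unit»
claims (erratum p. 4 ∕ weight-`k` CGS-type constant ∕ `h_𝒦·𝓛^{Katz}_𝒦|_{T_c=0}` of [FW21 App. B Cor. 7.21]) from what the line leans on.

MINTED FORM: `_of` ∕ `_proof` conclude the ROUTE DECL `Summit.BirchSwinnertonDyer.BirchSwinnertonDyer.Theses.ErratumRoadFive.ErratumThm23SigmaLeSelfDualIrrK`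
BY NAME (it unfolds definitionally to the Literature `Prop` F4♯‡, which is the conclusion of the tree theorem used). ON KEYING:
`ledger crux write <twin item> Lines/erratum_chain.lean --file <this>` + `ledger skeleton check <tree path> --crux <twin item>` (expected: `_of`
concludes the crux BY NAME; closed=False; ONE stub `stub_FW21_twoVarSigmaLeDivPinned_selfDual_irrK` registered).

* S1♭‡ `stub_FW21_twoVarSigmaLeDivPinned_selfDual_irrK` — THE OPEN CORE, print-faithful AND ♭-pinned: [FW21 Thm. 4.41] Σ-imprimitive
  two-variable divisibility at the self-dual twist `A_g^†` + App. B Cor. 7.21 ∕ L. 7.22 + «`L^Σ_p(g)` divides the anticyclotomic restriction»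
  + [Hsi14 Thm. B], under (i) irr_K and (iii) ∃ `q ∥ M` non-split.
* (no second stub) item 23081 `HidaOrdinaryUnitRootFact` BY NAME.

Composition (sorry-free, BY NAME): `ErratumThm23SigmaLeSelfDualIrrK_of hFW hW :=
  ErratumChainSelfDualIrrKDivPin.erratumThm23SigmaLeSelfDualIrrK_OPEN_of_twoVarCoreDivPinIrrK_of_thm326 hFW hW`. Consumers already in the
tree (unchanged — they take F4♯‡, not the stub): `Theorems.RekeyIrrK.multiplicativeRankOne_of_thm23SelfDualIrrK_OPEN_of_items` (g30, p688533),
`Theorems.RamFreeCloses.*` (g33, p701181). No summit statement and no crux is proved here; BSD is not advanced by this file.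
Stub statements by name: `Statement.stub_*`.

[claim: FouquetWan2021, Thm. 4.41, App. B Cor. 7.21, Lemma 7.22, status: under-review] [claim: Castella2018Erratum, Thm. 2.3, status: under-review]
[cite: JetchevSkinnerWan2017, §3.4, Lemma 3.4.1, Cor. 3.4.2] [cite: CastellaGrossiSkinner2025, Prop. 2.4.5] [cite: Hsieh2014, Thm. B]
[cite: Castella2018Erratum, §2 (p. 2), Lemma 2.1, Thm. 2.3 (i)–(iv) (p. 3)] [cite: Wiles1988, Thm. 2.2]
-/

noncomputable section

-- D-0017: single-problem summit, the namespace repeats the problem name by design.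
set_option linter.dupNamespace false

open scoped Classical

open PowerSeries NumberField IsDedekindDomain Field
  Literature.NumberTheory.EllipticCurves Literature.NumberTheory.EllipticCurves.ModularForms
  Literature.NumberTheory.EllipticCurves.BigGaloisRep Literature.NumberTheory.EllipticCurves.GreenbergSelmer
  Literature.NumberTheory.GaloisRepresentations

namespace Summit.BirchSwinnertonDyer.BirchSwinnertonDyer.Cruxes.ErratumThm23SigmaLeSelfDualIrrK.ErratumChain

/-! ## Registered stubs -/

/-- **S1♭‡ · `stub_FW21_twoVarSigmaLeDivPinned_selfDual_irrK` — the OPEN two-variable core, PRINT-FAITHFUL, ♭-PINNED (v2♭‡, imc-p1 g34)** (FW21 Thm. 4.41,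
Σ-imprimitive, ♭-pinned to `L^Σ_p(g)` — «`L^Σ_p(g)` DIVIDES the anticyclotomic restriction», cofactor NOT a unit — by FW21 App. B Cor. 7.21 ∕ L. 7.22 + the weight-`k` CGS calculation + Hsieh2014 Thm. B) FOR THE ERRATUM'S OWN MODULE
`X^Σ_K(A_g^†) := XBig κ' (AnticyclotomicBigGaloisRep κ (Δ.selfDualCofreeRepOver K)) 𝔭bar Σ`, under hypotheses (i) «`ρ̄_g|_{G_K}` irreducible»
and (iii) «some `q ∥ M` is non-split in `K`» AS PRINTED: S1† of `Cruxes/ErratumThm23SigmaLeSelfDual/Lines/erratum_chain.lean` v3‡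
BYTE-IDENTICAL except for the (i′) block and the ♭ pin. For `A_g^†` the anticyclotomic specialisation IS `T_c = 0`; the ♭ pin `constantCoeff Q₂ = c * Q`
asks only that `Q` DIVIDES `Q₂(T_c = 0)`. [claim: FouquetWan2021, Thm. 4.41 + App. B Cor. 7.21, status: under-review] [cite: CastellaGrossiSkinner2025, Prop. 2.4.5]
[cite: Hsieh2014, Thm. B] [cite: Castella2018Erratum, §2 (p. 2: "the self-dual Tate twist"), Thm. 2.3 (i), (iii), (2.4)] -/
theorem stub_FW21_twoVarSigmaLeDivPinned_selfDual_irrK :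
    ∀ {p : ℕ} [Fact p.Prime] (ι : PadicAlgCl p ≃+* ℂ) {M : ℕ} [NeZero M] {k : ℤ}
      (g : CuspForm (CongruenceSubgroup.Gamma0 M) k) (ιg : coeffField g →+* PadicAlgCl p)
      (Δ : OrdinaryNewformDatum g p ιg)
      (K : Type) [Field K] [NumberField K] (𝔭 𝔭bar : HeightOneSpectrum (𝓞 K)) (κ : ZpExtension K p)
      (γ : absoluteGaloisGroup K) [Fact (κ.IsTopGenerator γ)] (S : Finset (HeightOneSpectrum (𝓞 K))),
      IsNewform0 g → 2 ≤ k → Even k → 3 ≤ M → ¬ p ∣ M → 3 < p →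
      (∀ x : coeffField g, ι (ιg x) = (x : ℂ)) →
      ‖ιg ⟨(UpperHalfPlane.qExpansion 1 ⇑g).coeff p, coeff_mem_coeffField g p⟩‖ = 1 →
      IsImaginaryQuadratic K → (∃ β : ℤ, (4 * M : ℤ) ∣ β ^ 2 - NumberField.discr K) →
      ((Ideal.span {(p : ℤ)}).primesOver (𝓞 K)).ncard = 2 →
      ((p : ℕ) : 𝓞 K) ∈ 𝔭.asIdeal →
      (∀ (w : InfinitePlace K) (x : 𝓞 K), x ∈ 𝔭.asIdeal ↔ ‖ι.symm (w.embedding (x : K))‖ < 1) →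
      ((p : ℕ) : 𝓞 K) ∈ 𝔭bar.asIdeal → 𝔭bar ≠ 𝔭 →
      -- (i) AS PRINTED: `ρ̄_g|_{G_K}` irreducible (erratum Thm. 2.3 (i); [FW21, Thm. 4.41] first bullet)
      IsSimpleOrder (Subrepresentation
        ((SkinnerUrban2014.residualRep Δ).comp (absGaloisRestrict ℚ K : absoluteGaloisGroup K →* absoluteGaloisGroup ℚ))) →
      -- (iii) AS PRINTED: some prime `q ∥ M` is non-split in `K` (erratum Thm. 2.3 (iii); [FW21, Thm. 4.41] third bullet)
      (∃ q : ℕ, q.Prime ∧ q ∣ M ∧ ¬ q ^ 2 ∣ M ∧ ((Ideal.span {(q : ℤ)}).primesOver (𝓞 K)).ncard ≠ 2) →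
      (((Ideal.span {(2 : ℤ)}).primesOver (𝓞 K)).ncard ≠ 2 → (2 ∣ M ∧ ¬ 4 ∣ M)) →
      (∀ ℓ : ℕ, ℓ.Prime → ℓ ∣ M → ((Ideal.span {(ℓ : ℤ)}).primesOver (𝓞 K)).ncard ≠ 2 →
        ¬ ℓ ^ 2 ∣ M ∧ (UpperHalfPlane.qExpansion 1 ⇑g).coeff ℓ = -((ℓ : ℂ) ^ (k / 2 - 1).toNat)) →
      κ.IsAnticyclotomic → (∀ w ∈ S, ((p : ℕ) : 𝓞 K) ∉ w.asIdeal) →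
      (∀ w : HeightOneSpectrum (𝓞 K), ((M : ℕ) : 𝓞 K) ∈ w.asIdeal → w ∈ S) →
      ∀ (b : padicCoeffIntegers ιg →+* PadicComplexInt p),
        (∀ x, ((b x : PadicComplexInt p) : ℂ_[p]) =
          algebraMap (PadicAlgCl p) ℂ_[p] (padicCoeffIntegers.toPadicAlgCl ιg x)) →
      ∀ (ΩK : ℂ) (Ωp : (PadicComplexInt p)ˣ) (Q : PowerSeries (PadicComplexInt p)), ΩK ≠ 0 →
        IsBDPLFunctionWtSigmaInt ι 𝔭 κ γ g S ΩK ((Ωp : PadicComplexInt p) : ℂ_[p]) Q →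
      -- the complementary (cyclotomic) direction `κ'` with generator `γ'`: `Γ_K = Γ⁺ ⊕ Γ⁻ ≅ ℤ_p²` for `p` odd
      ∀ (κ' : ZpExtension K p) (γ' : absoluteGaloisGroup K) [Fact (κ'.IsTopGenerator γ')], κ'.IsCyclotomic →
      ∀ [TopologicalSpace (PowerSeries (padicCoeffIntegers ιg))]
        [TopologicalSpace (PowerSeries (PowerSeries (padicCoeffIntegers ιg)))]
        [ContinuousSMul (PowerSeries (PowerSeries (padicCoeffIntegers ιg)))
          (BigRepModule (PowerSeries (padicCoeffIntegers ιg)) p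
            (BigRepModule (padicCoeffIntegers ιg) p (Cofree Δ.selfDualRep (padicCoeffField ιg))))],
      -- premise: `X^Σ_K(A_g)` is `Λ_K`-torsion; conclusion: a two-variable frame pinned to `Q` on `X = 0` dividing `Ch_{Λ_K}(X^Σ_K(A_g))`
      Module.IsTorsion (PowerSeries (PowerSeries (padicCoeffIntegers ιg)))
          (XBig κ' (AnticyclotomicBigGaloisRep κ (Δ.selfDualCofreeRepOver K)) 𝔭bar (↑S)) →
      ∃ Q₂ : PowerSeries (PowerSeries (PadicComplexInt p)),
        -- ♭ pin (v2♭‡, imc-p1 g34): the frame `Q` DIVIDES `Q₂(T_c = 0)` — any cofactor `c`, NOT asked to be a unit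
        (∃ c : PowerSeries (PadicComplexInt p), PowerSeries.constantCoeff Q₂ = c * Q) ∧
        (XBig.charIdeal κ' (AnticyclotomicBigGaloisRep κ (Δ.selfDualCofreeRepOver K)) 𝔭bar (↑S)).map
            (PowerSeries.map (PowerSeries.map b)) ≤ Ideal.span {Q₂} := by
  sorry

/-! ## Stub statements by name -/

namespace Statement

/-- Statement of `stub_FW21_twoVarSigmaLeDivPinned_selfDual_irrK` (♭ pin) (the open two-variable core, self-dual module, printed (i)/(iii)). -/
abbrev stub_FW21_twoVarSigmaLeDivPinned_selfDual_irrK : Prop := type_of% @ErratumChain.stub_FW21_twoVarSigmaLeDivPinned_selfDual_irrK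

end Statement

/-! ## The composition (sorry-free): the stub STATEMENT and the route item 23081 imply the (twin) crux, BY NAME -/

/-- **`ErratumThm23SigmaLeSelfDualIrrK_of`** (v2♭‡) — the erratum's chain BY NAME at the printed hypotheses, over ONE stub (S1♭‡) and ONE route
item (`ErratumRoadFive.HidaOrdinaryUnitRootFact`, aside 23081 = [Wiles88 Thm 2.2 ∕ Hida00 Thm 3.26 (2)]): the tree theorem
`Theorems.ErratumThm23TwoVariable.ErratumChainSelfDualIrrKDivPin.erratumThm23SigmaLeSelfDualIrrK_OPEN_of_twoVarCoreDivPinIrrK_of_thm326` (imc-p1 g34,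
= p690124's body with the ♭ pin). Concludes the ROUTE DECL by name (unfolds definitionally to F4♯‡, the tree theorem's conclusion). Pure
logic here. [cite: Castella2018Erratum, (2.4) ⇒ (2.5) (p. 4)] [cite: Wiles1988, Thm. 2.2] -/
theorem ErratumThm23SigmaLeSelfDualIrrK_of (hFW : Statement.stub_FW21_twoVarSigmaLeDivPinned_selfDual_irrK)
    (hW : Summit.BirchSwinnertonDyer.BirchSwinnertonDyer.Theses.ErratumRoadFive.HidaOrdinaryUnitRootFact) :
    Summit.BirchSwinnertonDyer.BirchSwinnertonDyer.Theses.ErratumRoadFive.ErratumThm23SigmaLeSelfDualIrrK :=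
  Summit.BirchSwinnertonDyer.BirchSwinnertonDyer.Theorems.ErratumThm23TwoVariable.ErratumChainSelfDualIrrKDivPin.erratumThm23SigmaLeSelfDualIrrK_OPEN_of_twoVarCoreDivPinIrrK_of_thm326
    hFW hW

/-- The re-keyed crux‡ along this line — v1‡ minted (♭ pin): MODULO the route item 23081 (binder) and exactly the ONE stub (the only `sorry`
lives in `stub_FW21_twoVarSigmaLeDivPinned_selfDual_irrK`). -/
theorem ErratumThm23SigmaLeSelfDualIrrK_proof
    (hW : Summit.BirchSwinnertonDyer.BirchSwinnertonDyer.Theses.ErratumRoadFive.HidaOrdinaryUnitRootFact) :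
    Summit.BirchSwinnertonDyer.BirchSwinnertonDyer.Theses.ErratumRoadFive.ErratumThm23SigmaLeSelfDualIrrK :=
  ErratumThm23SigmaLeSelfDualIrrK_of stub_FW21_twoVarSigmaLeDivPinned_selfDual_irrK hW

end Summit.BirchSwinnertonDyer.BirchSwinnertonDyer.Cruxes.ErratumThm23SigmaLeSelfDualIrrK.ErratumChain

end
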